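import Literature.AlgebraicGeometry.Crystalline.HuComplexesTruncated
import Literature.Algebra.Homology.StaircaseScaling
import HarnessLib

/-!
# Dividing the inclusions of truncated staircase de Rham complexes by powers of `q`

Continuation of `Crystalline/HuComplexesTruncated`. For `M ≤ N` the inclusion of staircase de Rham
complexes `q^{(r-•)N}Ω• ⊆ q^{(r-•)M}Ω•` (`deRhamStaircaseLE`) multiplies, in degree `j`, the
torsion-free model `Ωʲ` by `q^{(r-j)(N-M)}` — which is divisible by `q^{N-M}` in the degrees
`j ≤ r - 1` (and not in the degrees `j ≥ r`, where it is the identity of `Ωʲ`). This file realises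
the division on the truncations `σ≤(r-1)`:

* the auxiliary staircase `q^{ê}Ω•`, `ê j = (r-j)N ∸ (N-M)` (`deRhamStaircaseHat X q r M N`), with
  the chain maps `(× q^{N-M}) : q^{ê}Ω• → q^{(r-•)N}Ω•` (`deRhamStaircaseHatMul`,
  `Algebra/Homology/StaircaseScaling.powImageMulLE`) and the inclusion `q^{ê}Ω• ⊆ q^{(r-•)M}Ω•`
  (`deRhamStaircaseHatLE`), satisfying **`(× q^{N-M}) ≫ (q^{(r-•)N} ⊆ q^{(r-•)M}) =
  q^{N-M} • (q^{ê} ⊆ q^{(r-•)M})`** (`deRhamStaircaseHatMul_comp_LE`, also `ℤ`-extended and truncated);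
* `(× q^{N-M})` is an isomorphism in the degrees `j < r` when the `Ωʲ` have no `q`-torsion
  (`isIso_deRhamStaircaseHatMul_f`), hence **an isomorphism on the truncations `σ≤(r-1)`**
  (`isIso_deRhamStaircaseHatTruncMul`, under `[∀ j, Mono (q • 𝟙 Ωʲ)]`, which holds for smooth
  `𝒳/W(k)` and `q = p`: `Crystalline/DeRhamComplexTorsionFree`).

Consequently the truncated inclusion `σ≤(r-1) q^{(r-•)N}Ω• → σ≤(r-1) q^{(r-•)M}Ω•` is `q^{N-M}` times a
chain map (the inverse of the iso followed by the truncated `q^{ê} ⊆ q^{(r-•)M}`), and every additive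
invariant of it — hypercohomology — has image divisible by `q^{N-M}`
(`KTheory/HuHypercohomologyDivisibility`). [folklore] Everything is proved; no named facts.
-/

noncomputable section

namespace Literature.AlgebraicGeometry.Crystalline

open CategoryTheory CategoryTheory.Limits _root_.AlgebraicGeometry _root_.TopologicalSpace
  Literature.Algebra.Homology

universe u

variable {A : Type u} [CommRing A] (X : Over (Spec (CommRingCat.of A))) (q : ℤ)

/-! ### The auxiliary staircase `ê j = (r-j)N ∸ (N-M)` -/

/-- The auxiliary exponent function `ê j = (r - j) N ∸ (N - M)` is antitone. [folklore] -/
theorem antitone_staircaseHat (r M N : ℕ) : Antitone fun j : ℕ ↦ (r - j) * N - (N - M) :=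
  fun _ _ hab ↦ Nat.sub_le_sub_right (antitone_staircase r N hab) _

/-- `(r - j) N ≤ ê j + (N - M)`: multiplication by `q^{N-M}` maps `q^{ê}` into `q^{(r-•)N}`.
[folklore] -/
theorem staircase_le_staircaseHat_add (r M N : ℕ) (j : ℕ) :
    (r - j) * N ≤ ((r - j) * N - (N - M)) + (N - M) :=
  le_tsub_add

/-- `(r - j) M ≤ ê j` for `M ≤ N`: the auxiliary staircase lies inside `q^{(r-•)M}Ω•`. [folklore] -/
theorem staircase_le_staircaseHat (r : ℕ) {M N : ℕ} (h : M ≤ N) :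
    (fun j : ℕ ↦ (r - j) * M) ≤ fun j ↦ (r - j) * N - (N - M) := by
  intro j
  change (r - j) * M ≤ (r - j) * N - (N - M)
  obtain ⟨t, rfl⟩ := Nat.exists_eq_add_of_le h
  rcases Nat.eq_zero_or_pos (r - j) with h0 | hpos
  · rw [h0, zero_mul]
    exact Nat.zero_le _
  · apply Nat.le_sub_of_add_le
    rw [Nat.add_sub_cancel_left, mul_add]
    exact Nat.add_le_add_left (Nat.le_mul_of_pos_left t hpos) _

/-- In a degree `j < r`, `ê j + (N - M) = (r - j) N` exactly (there `(r - j) N ≥ N ≥ N - M`).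
[folklore] -/
theorem staircaseHat_add_eq (r M N : ℕ) {j : ℕ} (hj : j < r) :
    ((r - j) * N - (N - M)) + (N - M) = (r - j) * N :=
  Nat.sub_add_cancel ((Nat.sub_le N M).trans (Nat.le_mul_of_pos_left N (Nat.sub_pos_of_lt hj)))

/-- **The auxiliary staircase de Rham complex `q^{ê}Ω•`**, `ê j = (r-j)N ∸ (N-M)`: in degrees
`j < r` it is `q^{(r-j)N - (N-M)}Ωʲ`, in degrees `j ≥ r` it is `Ωʲ`. [folklore] -/
abbrev deRhamStaircaseHat (r M N : ℕ) :
    CochainComplex (Sheaf (Opens.grothendieckTopology X.left) AddCommGrpCat.{u}) ℕ :=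
  powImage (algebraicDeRhamComplex X) q (antitone_staircaseHat r M N)

/-- **Multiplication by `q^{N-M}`**: `q^{ê}Ω• → q^{(r-•)N}Ω•`. [folklore] -/
abbrev deRhamStaircaseHatMul (r M N : ℕ) : deRhamStaircaseHat X q r M N ⟶ deRhamStaircase X q r N :=
  powImageMulLE (algebraicDeRhamComplex X) q (antitone_staircaseHat r M N) (antitone_staircase r N)
    (N - M) (staircase_le_staircaseHat_add r M N)

/-- The inclusion `q^{ê}Ω• ⊆ q^{(r-•)M}Ω•` (`M ≤ N`). [folklore] -/
abbrev deRhamStaircaseHatLE (r : ℕ) {M N : ℕ} (h : M ≤ N) :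
    deRhamStaircaseHat X q r M N ⟶ deRhamStaircase X q r M :=
  powImageLE (algebraicDeRhamComplex X) q (antitone_staircase r M) (antitone_staircaseHat r M N)
    (staircase_le_staircaseHat r h)

/-- **`(× q^{N-M}) ≫ (q^{(r-•)N} ⊆ q^{(r-•)M}) = q^{N-M} • (q^{ê} ⊆ q^{(r-•)M})`** (`M ≤ N`): the
inclusion of staircase de Rham complexes, pulled back along multiplication by `q^{N-M}`, is
`q^{N-M}` times an inclusion. [folklore] -/
theorem deRhamStaircaseHatMul_comp_LE (r : ℕ) {M N : ℕ} (h : M ≤ N) :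
    deRhamStaircaseHatMul X q r M N ≫ deRhamStaircaseLE X q r h =
      (q ^ (N - M) : ℤ) • deRhamStaircaseHatLE X q r h :=
  powImageMulLE_comp_powImageLE _ q _ _ _ _ (antitone_staircase r M) (staircase_le_staircase r h)
    (staircase_le_staircaseHat r h)

/-- **In the degrees `j < r`, `(× q^{N-M}) : q^{ê j}Ωʲ → q^{(r-j)N}Ωʲ` is an isomorphism** when `Ωʲ`
has no `q`-torsion. [folklore] -/
theorem isIso_deRhamStaircaseHatMul_f (r M N : ℕ) {j : ℕ} (hj : j < r)
    [Mono ((q : ℤ) • 𝟙 ((algebraicDeRhamComplex X).X j))] :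
    IsIso ((deRhamStaircaseHatMul X q r M N).f j) :=
  isIso_powImageMulLE_f _ q _ _ _ _ j (staircaseHat_add_eq r M N hj)

/-! ### `ℤ`-extensions and truncations -/

/-- The auxiliary staircase as a `ℤ`-indexed complex. [folklore] -/
abbrev deRhamStaircaseHatInt (r M N : ℕ) :
    CochainComplex (Sheaf (Opens.grothendieckTopology X.left) AddCommGrpCat.{u}) ℤ :=
  (deRhamStaircaseHat X q r M N).extend ComplexShape.embeddingUpNat

/-- The truncation `σ≤(r-1) q^{ê}Ω•`. [folklore] -/
abbrev deRhamStaircaseHatTrunc (r M N : ℕ) :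
    CochainComplex (Sheaf (Opens.grothendieckTopology X.left) AddCommGrpCat.{u}) ℤ :=
  stupidTruncLE (deRhamStaircaseHatInt X q r M N) ((r : ℤ) - 1)

/-- `σ≤(r-1) q^{ê}Ω•` is strictly concentrated in degrees `≥ 0` (hyper-Ext smallness). [folklore] -/
instance isStrictlyGE_deRhamStaircaseHatTrunc (r M N : ℕ) :
    (deRhamStaircaseHatTrunc X q r M N).IsStrictlyGE 0 :=
  inferInstance

/-- The truncated multiplication `σ≤(r-1) q^{ê}Ω• → σ≤(r-1) q^{(r-•)N}Ω•`. [folklore] -/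
abbrev deRhamStaircaseHatTruncMul (r M N : ℕ) :
    deRhamStaircaseHatTrunc X q r M N ⟶ deRhamStaircaseTrunc X q r N :=
  stupidTruncLEMap (HomologicalComplex.extendMap (deRhamStaircaseHatMul X q r M N)
    ComplexShape.embeddingUpNat) ((r : ℤ) - 1)

/-- The truncated inclusion `σ≤(r-1) q^{ê}Ω• → σ≤(r-1) q^{(r-•)M}Ω•` (`M ≤ N`). [folklore] -/
abbrev deRhamStaircaseHatTruncLE (r : ℕ) {M N : ℕ} (h : M ≤ N) :
    deRhamStaircaseHatTrunc X q r M N ⟶ deRhamStaircaseTrunc X q r M :=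
  stupidTruncLEMap (HomologicalComplex.extendMap (deRhamStaircaseHatLE X q r h)
    ComplexShape.embeddingUpNat) ((r : ℤ) - 1)

/-- **`(× q^{N-M}) ≫ incl = q^{N-M} • incl̂` on the truncations** (`M ≤ N`). [folklore] -/
theorem deRhamStaircaseHatTruncMul_comp_TruncLE (r : ℕ) {M N : ℕ} (h : M ≤ N) :
    deRhamStaircaseHatTruncMul X q r M N ≫ deRhamStaircaseTruncLE X q r h =
      (q ^ (N - M) : ℤ) • deRhamStaircaseHatTruncLE X q r h := by
  change HomologicalComplex.stupidTruncMap _ _ ≫ HomologicalComplex.stupidTruncMap _ _ =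
    (q ^ (N - M) : ℤ) • HomologicalComplex.stupidTruncMap _ _
  rw [← HomologicalComplex.stupidTruncMap_comp, ← HomologicalComplex.extendMap_comp,
    deRhamStaircaseHatMul_comp_LE, extendMap_zsmul, stupidTruncMap_zsmul]

/-- A morphism between zero objects is an isomorphism. [folklore] -/
theorem isIso_of_isZero_of_isZero {C : Type*} [Category C] [HasZeroMorphisms C] {Y Z : C}
    (f : Y ⟶ Z) (hY : IsZero Y) (hZ : IsZero Z) : IsIso f :=
  ⟨⟨0, hY.eq_of_src _ _, hZ.eq_of_src _ _⟩⟩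

/-- The terms of a truncation `σ≤n` of a `ℤ`-extension of an `ℕ`-complex vanish in negative degrees.
[folklore] -/
theorem isZero_stupidTruncLE_extend_X_of_neg
    (K : CochainComplex (Sheaf (Opens.grothendieckTopology X.left) AddCommGrpCat.{u}) ℕ) (n i : ℤ)
    (hi : i < 0) : IsZero ((stupidTruncLE (K.extend ComplexShape.embeddingUpNat) n).X i) := by
  by_cases hin : i ≤ n
  · exact IsZero.of_iso (K.isZero_extend_X ComplexShape.embeddingUpNat i fun j hj ↦ by
      change ((j : ℕ) : ℤ) = i at hj; omega) (stupidTruncLEXIso _ n i hin)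
  · exact isZero_stupidTruncLE_X _ n i (lt_of_not_ge hin)

/-- **`(× q^{N-M}) : σ≤(r-1) q^{ê}Ω• ⥲ σ≤(r-1) q^{(r-•)N}Ω•` is an isomorphism** when the `Ωʲ` have no
`q`-torsion (degreewise: the degrees `0 ≤ j ≤ r - 1` by `isIso_deRhamStaircaseHatMul_f`, zero
objects elsewhere). [folklore] -/
theorem isIso_deRhamStaircaseHatTruncMul (r M N : ℕ)
    [∀ j, Mono ((q : ℤ) • 𝟙 ((algebraicDeRhamComplex X).X j))] :
    IsIso (deRhamStaircaseHatTruncMul X q r M N) := by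
  haveI : ∀ i : ℤ, IsIso ((deRhamStaircaseHatTruncMul X q r M N).f i) := by
    intro i
    by_cases hi : i ≤ (r : ℤ) - 1
    · by_cases hi0 : 0 ≤ i
      · -- `i = j` with `j < r`: the component is conjugate to `(× q^{N-M})ʲ`
        obtain ⟨j, rfl⟩ := Int.eq_ofNat_of_zero_le hi0
        have hj : j < r := by omega
        have hf : ComplexShape.embeddingUpNat.f j = (j : ℤ) := rfl
        haveI := isIso_deRhamStaircaseHatMul_f X q r M N hj
        rw [stupidTruncLEMap_f_eq _ _ _ hi,
          HomologicalComplex.extendMap_f (deRhamStaircaseHatMul X q r M N) _ hf]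
        infer_instance
      · exact isIso_of_isZero_of_isZero _
          (isZero_stupidTruncLE_extend_X_of_neg X _ _ i (lt_of_not_ge hi0))
          (isZero_stupidTruncLE_extend_X_of_neg X _ _ i (lt_of_not_ge hi0))
    · exact isIso_of_isZero_of_isZero _ (isZero_stupidTruncLE_X _ _ i (lt_of_not_ge hi))
        (isZero_stupidTruncLE_X _ _ i (lt_of_not_ge hi))
  exact HomologicalComplex.Hom.isIso_of_components _

end Literature.AlgebraicGeometry.Crystalline

end
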